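import Mathlib

/-!
# PF persistence, fake family F6: the weak-duality certificate behind the joint-magnitude depth ceiling (GAP row F6-G3)

mechanism/rigidity campaign; no RH claims.

The depth ceiling `D*(a,N)` of the arithmetic mirror-twin family F6 is computed as the value of a
linear Chebyshev problem
  `t* = min { max_f |(A x)_f| : C x = d, |x_c| ≤ B_c }`
and CERTIFIED from below by exhibiting a dual point `(ν, λ)`: for every feasible `x`,
  `(∑_f |ν_f|) · max_f |(A x)_f| ≥ |d ⬝ λ| − ∑_c B_c · |(Aᵀ ν − Cᵀ λ)_c|`.
This file PROVES that inequality (pure linear algebra over `ℝ`, finite index types), so that the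
published certificates are `PROVED principle + interval-evaluated DATA`: the job evaluates the
right-hand side in interval arithmetic at the simplex-optimal dual point.
-/

namespace Summit.RiemannHypothesis.RiemannHypothesis.Theorems.PfPersistence.F6Dual

open Matrix BigOperators Finset

variable {nf nc k : ℕ}

/-- `|v ⬝ᵥ w| ≤ ∑ |v i| * |w i|`. -/
lemma abs_dotProduct_le (v w : Fin nc → ℝ) :
    |v ⬝ᵥ w| ≤ ∑ i, |v i| * |w i| := by
  unfold dotProduct
  calc |∑ i, v i * w i| ≤ ∑ i, |v i * w i| := Finset.abs_sum_le_sum_abs _ _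
    _ = ∑ i, |v i| * |w i| := by simp [abs_mul]

/-- WEAK DUALITY for the boxed, equality-constrained linear Chebyshev problem.
For any `x` with `C x = d`, `|x_c| ≤ B_c` and `|(A x)_f| ≤ t` for all `f`, and ANY multipliers
`ν` (on the objective rows) and `λ` (on the equality constraints):
`|d ⬝ λ| − ∑_c B_c |(Aᵀ ν − Cᵀ λ)_c| ≤ (∑_f |ν_f|) · t`. -/
theorem weak_duality (A : Matrix (Fin nf) (Fin nc) ℝ) (C : Matrix (Fin k) (Fin nc) ℝ)
    (d : Fin k → ℝ) (B : Fin nc → ℝ) (x : Fin nc → ℝ)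
    (hx : C *ᵥ x = d) (hbox : ∀ c, |x c| ≤ B c)
    (ν : Fin nf → ℝ) (lam : Fin k → ℝ) (t : ℝ) (ht : ∀ f, |(A *ᵥ x) f| ≤ t) :
    |d ⬝ᵥ lam| - ∑ c, B c * |(Aᵀ *ᵥ ν - Cᵀ *ᵥ lam) c| ≤ (∑ f, |ν f|) * t := by
  set ρ : Fin nc → ℝ := Aᵀ *ᵥ ν - Cᵀ *ᵥ lam with hρ
  -- d ⬝ lam = x ⬝ (Cᵀ lam)
  have h1 : d ⬝ᵥ lam = x ⬝ᵥ (Cᵀ *ᵥ lam) := by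
    rw [← hx, Matrix.mulVec_transpose, dotProduct_comm (C *ᵥ x) lam,
      Matrix.dotProduct_mulVec, dotProduct_comm]
  -- x ⬝ (Aᵀ ν) = ν ⬝ (A x)
  have h2 : x ⬝ᵥ (Aᵀ *ᵥ ν) = ν ⬝ᵥ (A *ᵥ x) := by
    rw [Matrix.mulVec_transpose, Matrix.dotProduct_mulVec, dotProduct_comm]
  have h3 : Cᵀ *ᵥ lam = Aᵀ *ᵥ ν - ρ := by rw [hρ]; abel
  have h4 : d ⬝ᵥ lam = ν ⬝ᵥ (A *ᵥ x) - x ⬝ᵥ ρ := by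
    rw [h1, h3, dotProduct_sub, h2]
  -- bound the two pieces
  have hν : |ν ⬝ᵥ (A *ᵥ x)| ≤ (∑ f, |ν f|) * t := by
    calc |ν ⬝ᵥ (A *ᵥ x)| ≤ ∑ f, |ν f| * |(A *ᵥ x) f| := abs_dotProduct_le _ _
      _ ≤ ∑ f, |ν f| * t := by
          apply Finset.sum_le_sum; intro f _
          exact mul_le_mul_of_nonneg_left (ht f) (abs_nonneg _)
      _ = (∑ f, |ν f|) * t := by rw [Finset.sum_mul]
  have hxρ : |x ⬝ᵥ ρ| ≤ ∑ c, B c * |ρ c| := by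
    calc |x ⬝ᵥ ρ| ≤ ∑ c, |x c| * |ρ c| := abs_dotProduct_le _ _
      _ ≤ ∑ c, B c * |ρ c| := by
          apply Finset.sum_le_sum; intro c _
          exact mul_le_mul_of_nonneg_right (hbox c) (abs_nonneg _)
  have h5 : |d ⬝ᵥ lam| ≤ |ν ⬝ᵥ (A *ᵥ x)| + |x ⬝ᵥ ρ| := by
    rw [h4]; exact abs_sub _ _
  linarith

/-- The certificate in the form the jobs print it: with `s₁ = ∑_f |ν_f| > 0`,
every feasible design has visibility `t ≥ (|d ⬝ λ| − ∑_c B_c |ρ_c|) / s₁`; hence no member of the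
boxed family is jointly invisible below that level (`D ≤ −lg` of it). -/
theorem certified_lower_bound (A : Matrix (Fin nf) (Fin nc) ℝ) (C : Matrix (Fin k) (Fin nc) ℝ)
    (d : Fin k → ℝ) (B : Fin nc → ℝ) (x : Fin nc → ℝ)
    (hx : C *ᵥ x = d) (hbox : ∀ c, |x c| ≤ B c)
    (ν : Fin nf → ℝ) (lam : Fin k → ℝ) (t : ℝ) (ht : ∀ f, |(A *ᵥ x) f| ≤ t)
    (hs : 0 < ∑ f, |ν f|) :
    (|d ⬝ᵥ lam| - ∑ c, B c * |(Aᵀ *ᵥ ν - Cᵀ *ᵥ lam) c|) / (∑ f, |ν f|) ≤ t := by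
  rw [div_le_iff₀ hs]
  have := weak_duality A C d B x hx hbox ν lam t ht
  linarith

/-- Equivalently: if the certified level `ℓ = (|d ⬝ λ| − ∑ B_c|ρ_c|)/s₁` is positive, NO feasible
design achieves joint visibility `t < ℓ` — the family-level depth ceiling. -/
theorem no_design_below_certificate (A : Matrix (Fin nf) (Fin nc) ℝ) (C : Matrix (Fin k) (Fin nc) ℝ)
    (d : Fin k → ℝ) (B : Fin nc → ℝ) (ν : Fin nf → ℝ) (lam : Fin k → ℝ)
    (hs : 0 < ∑ f, |ν f|) (t : ℝ)
    (hlt : t < (|d ⬝ᵥ lam| - ∑ c, B c * |(Aᵀ *ᵥ ν - Cᵀ *ᵥ lam) c|) / (∑ f, |ν f|)) :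
    ¬ ∃ x : Fin nc → ℝ, C *ᵥ x = d ∧ (∀ c, |x c| ≤ B c) ∧ ∀ f, |(A *ᵥ x) f| ≤ t := by
  rintro ⟨x, hx, hbox, ht⟩
  have := certified_lower_bound A C d B x hx hbox ν lam t ht hs
  linarith

end Summit.RiemannHypothesis.RiemannHypothesis.Theorems.PfPersistence.F6Dual
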